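import Summits.BirchSwinnertonDyer.BirchSwinnertonDyer.Theses.VerticalContact
import Summits.BirchSwinnertonDyer.BirchSwinnertonDyer.Theses.LeadingTerm
import Literature.NumberTheory.EllipticCurves.KatoRankBound
import Literature.NumberTheory.EllipticCurves.KatoRankBoundSelmerProofs
import HarnessLib

/-!
# Route VerticalContact — crux `PGSelmerBSD` (stmt-BirchSwinnertonDyer-17810), line `Sketch`,
# stub `stub_katoBound` from the shared ITEM `KatoDivisibility` (stmt-BirchSwinnertonDyer-18082) by name

Registered stub 3 of `Cruxes/PGSelmerBSD/Lines/Sketch.lean` — at an admissible prime `p` (`p ≥ 5`, good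
ordinary, `ρ̄_{E,p}` surjective) of a curve with `r_an ≥ 2`, `corank_{ℤ_p} Sel_{p^∞}(E/ℚ) ≤ ord_{T=0} L_p(f,α,T)`
for every newform `f` — follows BY NAME from the shared route item `LeadingTerm.KatoDivisibility`
(stmt-BirchSwinnertonDyer-18082; the same term as route PAdicOrderV2's `KatoDivisibility`): for odd good
ordinary `p`, every cyclotomic datum `(κ, γ)` and every Pontryagin-dual datum `D` of `Sel_{p^∞}(E/ℚ_∞)`,
`X = D.X` is `Λ`-torsion and `p^n L_p(E,T) = ι g` for some `g ∈ char_Λ X` (K. Kato, Astérisque 295 (2004),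
Thm 17.4 (1)(2); the item drops the integral clause (3) of the named fact `kato_divisibility`, which is not
used here). The route-choice record `ROUTE-CHOICE-VerticalContactStubKatoBound.md` (item evidence,
2026-08-17) promoted exactly this statement to the crux behind stub 3; this file is the Theorems form of
that rewiring. Proof = the tree's reduction `kato_selmerCorank_le_order_padicLFunction_of_data'`
(file `KatoRankBoundSelmerProofs`) re-run on the item's two clauses: cyclotomic datum
(`exists_isCyclotomic_isTopGenerator_isCyclotomicVariable_holds`), dual datum
(`nonempty_selmerDualData_holds`), finite generation over `Λ` (`finite_selmerInfty_pTorsion_invariants_holds`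
+ Nakayama), `corank Sel ≤ rank_{ℤ_p} X/TX ≤ ord g ≤ ord (ι g) = ord (p^n L_p) = ord L_p` — all proved.
CONDITIONAL on the item (open, shared with routes LeadingTerm / PAdicOrderV2).
-/

-- D-0017: single-problem summit, so `Summit.BirchSwinnertonDyer.BirchSwinnertonDyer.…` repeats a
-- namespace BY DESIGN.
set_option linter.dupNamespace false

namespace Summit.BirchSwinnertonDyer.BirchSwinnertonDyer.Theorems

open scoped MatrixGroups ModularForm
open CongruenceSubgroup Literature.NumberTheory.EllipticCurves
  Literature.NumberTheory.EllipticCurves.ModularForms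

/-- **Stub `stub_katoBound` of line `Sketch` (crux `PGSelmerBSD`) from the shared item
`KatoDivisibility` (stmt-18082) by name.** Antecedent: `LeadingTerm.KatoDivisibility` (Kato 2004,
Thm 17.4 (1)(2) at every odd good ordinary prime, every cyclotomic datum and every dual datum).
Consequent: the registered stub verbatim. At `p ≥ 5` good ordinary: pick a cyclotomic datum `(κ, γ)`
and a dual datum `D` (tree theorems), get `X` torsion and `ι g = p^n · L_p` with `g ∈ char X` from the
item, and chain `corank Sel ≤ rank X/TX ≤ ord g ≤ ord (ι g) = ord L_p`. The binders `ρ̄` surjective and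
`2 ≤ r_an` are not used. CONDITIONAL on the item.
[cite: Kato2004Asterisque, Thm. 17.4 (p. 273) and Thm. 18.4 (p. 281)] -/
theorem stub_katoBound_of_katoDivisibility : Summit.BirchSwinnertonDyer.BirchSwinnertonDyer.Theses.LeadingTerm.KatoDivisibility → ∀ (W : WeierstrassCurve ℚ) [W.IsElliptic] [W.IsGloballyMinimal] (p : ℕ) [Fact p.Prime], 5 ≤ p → W.HasGoodReductionAtPrime p → ¬ (p : ℤ) ∣ W.frobeniusTrace p → W.HasSurjectiveModNGaloisRep p → 2 ≤ W.analyticRank → ∀ {N : ℕ} [NeZero N] (f : CuspForm (Gamma0 N) 2), IsNewformOf W f → (W.selmerCorank p : ℕ∞) ≤ (padicLFunction f (unitRoot W p : ℚ_[p])).order := by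
  intro hK W _ _ p _ h5 hgood hord _hsurj _h2 N _ f hf
  have hp : p ≠ 2 := by omega
  have hordin : IsOrdinaryAt W p := ⟨hgood, hord⟩
  obtain ⟨κ, hκ, γ, hγ, hγ'⟩ := exists_isCyclotomic_isTopGenerator_isCyclotomicVariable_holds p
  obtain ⟨D⟩ := W.nonempty_selmerDualData_holds κ γ hγ
  haveI : Module.Finite (IwasawaAlgebra p) D.X :=
    D.module_finite_of_finite_pTorsion_invariants W
      (W.finite_selmerInfty_pTorsion_invariants_holds κ γ) hκ hγ
  obtain ⟨htors, n, g, hg, hιg⟩ := hK W p hp hordin κ γ hκ hγ hγ' f hf D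
  -- `corank Sel ≤ rank X/TX ≤ ord g`
  have h0 : (W.selmerCorank p : ℕ∞) ≤ (IwasawaAlgebra.coinvariantsRank p D.X : ℕ∞) := by
    exact_mod_cast W.selmerCorank_le_coinvariantsRank hγ D
  have h1 : (W.selmerCorank p : ℕ∞) ≤ PowerSeries.order g :=
    h0.trans (IwasawaAlgebra.coinvariantsRank_le_order_of_mem_charIdeal D.X htors g hg)
  -- `ord g ≤ ord (ι g)` (coefficientwise `ℤ_p → ℚ_p`)
  have h2 : PowerSeries.order g ≤ PowerSeries.order (iwasawaToPowerSeries p g) :=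
    PowerSeries.le_order_map _
  -- `ord (ι g) = ord (p^n L_p) = ord L_p`
  have hpn : IsUnit (PowerSeries.C ((p : ℚ_[p]) ^ n)) := by
    refine IsUnit.map PowerSeries.C (IsUnit.mk0 _ (pow_ne_zero n ?_))
    exact_mod_cast (Fact.out : p.Prime).ne_zero
  have h3 : PowerSeries.order (iwasawaToPowerSeries p g) =
      PowerSeries.order (padicLFunction f (unitRoot W p : ℚ_[p])) := by
    rw [hιg, PowerSeries.order_mul, PowerSeries.order_zero_of_unit hpn, zero_add]
  exact h3 ▸ h1.trans h2

end Summit.BirchSwinnertonDyer.BirchSwinnertonDyer.Theorems
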